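import Mathlib
import HarnessLib
import Summits.Ventures.LatticeQCDFlow.Exactness.SUNStoutLayerJacobianDet
import Summits.Ventures.LatticeQCDFlow.Exactness.EquivariantJacobianGaugeInvariance

/-!
# The stout layer's closed-form log-det is a class function

HONEST FRAMING: exact (Metropolis-corrected) sampling algorithms for lattice gauge theory;
figures of merit are autocorrelation/cost numbers at stated couplings and volumes; no
continuum-physics claim.

Venture `LatticeQCDFlow` (cell pub-lqcd), topic `Exactness`; FANOUT row 10 (`eng-equiv`: `SUNStoutLayer` /
`flows_jax.layers.sun_stout`, equivariance tests).  NEW WORK of the cell; no definition (local notations only); nothing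
cited as a fact.  File 13 of the series "the residual layer's exact Jacobian IS the closed form".

* **`isGaugeInvariant_prod_det_sunStoutTangentOp`** — the STOUT layer's closed-form Jacobian `∏_{a active} det TopS[1, U, a]`
  (`SUNStoutLayerJacobianDet`) is gauge invariant: `∏_a det TopS[1, U^g, a] = ∏_a det TopS[1, U, a]`, under its hypotheses
  plus continuity of the frozen-link coefficient and its invariance under gauge transformations
  (`isGaugeInvariant_of_hasJacobian` of `EquivariantJacobianGaugeInvariance`, `isGaugeEquivariant_sunStoutLayer`,
  `exists_measurableEquiv_sunStoutLatticeLayer`) — the engine's "log-det gauge invariance" unit test as a theorem, every `N`.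

Printed counterparts, NAMED ONLY: Morningstar–Peardon, PRD 69 (2004) 054501; Abbott et al., arXiv:2305.02402 §4.2;
Boyda et al., PRD 103 (2021) 074504.
-/

noncomputable section

namespace Summit.Ventures.LatticeQCDFlow.Exactness

open Literature.MathematicalPhysics.QuantumFieldTheory
open Literature.MathematicalPhysics.QuantumFieldTheory.Luscher2010
open Literature.MathematicalPhysics.QuantumFieldTheory.WilsonFlow
open MeasureTheory Filter Set
open scoped Matrix Matrix.Norms.Frobenius Topology ContDiff ENNReal

/-! ## The stout layer: the booked log-det is a class function -/

section Stout

variable {d L n : ℕ} [NeZero L] (p : Edge d L → Prop) [DecidablePred p] (Ramb : Edge d L → AmbConfig d L n → ℝ)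

set_option quotPrecheck false in
/-- The STOUT isotopy at time `τ` (local notation, as in `SUNStoutLayerJacobianDet`). -/
local notation "fambS[" τ "]" => (fun (W : AmbConfig d L n) (e : Edge d L) =>
  if h : p e then NormedSpace.exp ((τ : ℝ) • ((Ramb e W : ℂ) • suProj (loopSumAmb W e.1 e.2))) * W e else W e)

set_option quotPrecheck false in
/-- The block of the stout tangential operator (local notation, as in `SUNStoutLayerJacobianDet`). -/
local notation "BlkS[" τ ", " W ", " a "]" =>
  ((fderiv ℝ (fun Y : Matrix (Fin n) (Fin n) ℂ => Y * ((fambS[τ]) W a)ᴴ) 0).comp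
    ((fderiv ℝ (fun W' : AmbConfig d L n => W' a) 0).comp
      ((fderiv ℝ (fambS[τ]) W).comp
        ((fderiv ℝ (fun Y : Matrix (Fin n) (Fin n) ℂ => (Pi.single a Y : AmbConfig d L n)) 0).comp
          (fderiv ℝ (fun Y : Matrix (Fin n) (Fin n) ℂ => Y * W a) 0)))))

set_option quotPrecheck false in
/-- The stout tangential operator (local notation, as in `SUNStoutLayerJacobianDet`). -/
local notation "TopS[" τ ", " W ", " a "]" =>
  ((fderiv ℝ (suProj (n := n)) 0).comp ((BlkS[τ, W, a]).comp (fderiv ℝ (suProj (n := n)) 0)) +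
    (ContinuousLinearMap.id ℝ (Matrix (Fin n) (Fin n) ℂ) - fderiv ℝ (suProj (n := n)) 0))

/-- **The stout layer's closed-form Jacobian is gauge invariant** (the engine's "log-det gauge invariance"
unit test, as a theorem): under the hypotheses of `hasJacobian_sunStoutLatticeLayer_det` plus continuity of the
frozen-link coefficient `R e` and its invariance under gauge transformations of the frozen links (`hρg`),
`∏_{a active} det TopS[1, U^g, a] = ∏_{a active} det TopS[1, U, a]` for every gauge transformation `g`. -/
theorem isGaugeInvariant_prod_det_sunStoutTangentOp
    (ρ : GaugeConfig d L (Matrix.specialUnitaryGroup (Fin n) ℂ) → Edge d L → ℝ)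
    (R : (e : Edge d L) → ({f : Edge d L // ¬p f} → Matrix.specialUnitaryGroup (Fin n) ℂ) → ℝ)
    (hR : ∀ V e, p e → ρ V e = R e (fun f => V f)) (hRc : ∀ e, p e → Continuous (R e))
    (hρg : ∀ (g : Site d L → Matrix.specialUnitaryGroup (Fin n) ℂ)
      (V : GaugeConfig d L (Matrix.specialUnitaryGroup (Fin n) ℂ)) (e : Edge d L), p e →
        ρ (gaugeTransform g V) e = ρ V e)
    (h1 : ∀ e, p e → ∀ ν, ν ≠ e.2 → ¬p (e.1.shift e.2, ν))
    (h2 : ∀ e, p e → ∀ ν, ν ≠ e.2 → ¬p (e.1.shift ν, e.2))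
    (h3 : ∀ e, p e → ∀ ν, ν ≠ e.2 → ¬p (e.1, ν))
    (h4 : ∀ e, p e → ∀ ν, ν ≠ e.2 → ¬p ((e.1 - Pi.single ν 1).shift e.2, ν))
    (h5 : ∀ e, p e → ∀ ν, ν ≠ e.2 → ¬p (e.1 - Pi.single ν 1, e.2))
    (h6 : ∀ e, p e → ∀ ν, ν ≠ e.2 → ¬p (e.1 - Pi.single ν 1, ν))
    (hκ : ∀ e y, p e → 2 * (d - 1 : ℝ) * |R e y| < 1)
    (hRamb2 : ∀ e, ContDiff ℝ 2 (Ramb e))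
    (hRambR : ∀ (V : GaugeConfig d L (Matrix.specialUnitaryGroup (Fin n) ℂ)) e, p e →
      Ramb e (coeConfig V) = R e (fun f => V f)) :
    IsGaugeInvariant (fun U : GaugeConfig d L (Matrix.specialUnitaryGroup (Fin n) ℂ) =>
      ∏ a : {e : Edge d L // p e}, (TopS[(1 : ℝ), coeConfig U, a.1]).det) := by
  haveI : SecondCountableTopology (Matrix (Fin n) (Fin n) ℂ) :=
    inferInstanceAs (SecondCountableTopology (Fin n → Fin n → ℂ))
  haveI : SecondCountableTopology (Matrix.specialUnitaryGroup (Fin n) ℂ) :=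
    Topology.IsEmbedding.subtypeVal.secondCountableTopology
  obtain ⟨hcont, hpos, hJ⟩ := hasJacobian_sunStoutLatticeLayer_det p Ramb ρ R hR h1 h2 h3 h4 h5 h6 hκ hRamb2 hRambR
  obtain ⟨Ψ, hΨ⟩ := exists_measurableEquiv_sunStoutLatticeLayer p ρ R hR hRc h1 h2 h3 h4 h5 h6 hκ
  have hequiv : IsGaugeEquivariant (Ψ : GaugeConfig d L (Matrix.specialUnitaryGroup (Fin n) ℂ) →
      GaugeConfig d L (Matrix.specialUnitaryGroup (Fin n) ℂ)) := by
    rw [hΨ]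
    exact isGaugeEquivariant_sunStoutLayer p ρ hρg
  have hJΨ : HasJacobian (Measure.pi fun _ : Edge d L => haarProbability (Matrix.specialUnitaryGroup (Fin n) ℂ)) Ψ
      (fun U => ENNReal.ofReal (∏ a : {e : Edge d L // p e}, (TopS[(1 : ℝ), coeConfig U, a.1]).det)) := by
    rw [hΨ]
    exact hJ
  exact isGaugeInvariant_of_hasJacobian hequiv hcont (fun U => (hpos U).le) hJΨ

end Stout

end Summit.Ventures.LatticeQCDFlow.Exactness

end
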